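import Mathlib
import HarnessLib
import Literature.Probability.MarkovChains.HypercubeLowerBound
import Literature.Probability.MarkovChains.SpectralGapVariational
import Literature.Probability.MarkovChains.ReversibleSpectrumReal
import Literature.Probability.MarkovChains.SpectralRepresentation
import Literature.Probability.MarkovChains.RelaxationTimeLowerBound

/-!
# The lazy walk on the hypercube: eigenfunctions `f_J(x) = Π_{j∈J} x_j`, eigenvalues `(n − |J|)/n`, and `γ = γ⋆ = 1/n`, `t_rel = n` (Levin–Peres–Wilmer Example 12.16)

HONEST FRAMING: exact (Metropolis-corrected) sampling algorithms for lattice gauge theory; figures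
of merit are autocorrelation/cost numbers at stated couplings and volumes; no continuum-physics claim.

Conventions of `HardcoreGlauberGrandCoupling.lean` Part C (`lazyHypercubeWalk V` on `V → Bool`, run
by random refreshes `refreshMap`/`refreshWeight`; the grand coupling `randomMapCoupling`,
`randomMapExpected`; `uniformCube`), `HypercubeLowerBound.lean` (`bitVal`, `flipAt`,
`randomMapKernel_sum_mul`, `sum_centered_mul_eq_zero`), `SpectralGapVariational.lean`
(`orthEigenvalues`, `spectralGap = γ`, Lemma 13.7), `RelaxationTime.lean` (`absSpectralGap = γ⋆`,
`relaxationTime = t_rel`), `ReversibleSpectrumReal.lean` (`absSpectralGap_le_spectralGap`),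
`ContractionSpectralGap.lean` (Theorem 13.1) and `SpectralRepresentation.lean` (Theorem 12.4).
Source: D. A. Levin, Y. Peres (with E. L. Wilmer), *Markov Chains and Mixing Times*, 2nd ed., AMS
2017 [LevinPeres2017], §12.4 Example 12.16 (p. 171).  Everything is PROVED (0 named facts).

Writing the state space as `{−1,1}ⁿ` through `spinSign x j = ±1`:
* `spinProd J = f_J`, **`f_J(x) := Π_{j∈J} x_j`**; `LevinPeres2017_example_12_16` — **`P f_J =
  ((n − |J|)/n) f_J`** ("`f_J` is an eigenfunction. The corresponding eigenvalue is
  `λ_J = Σ_i (1 − 1{i∈J})/n = (n − |J|)/n`"), from `Σ_b f_J(x^{i←b}) = 0` for `i ∈ J` and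
  `f_J(x^{i←b}) = f_J(x)` for `i ∉ J` [cite: LevinPeres2017, §12.4 Example 12.16];
* `spinProd_orth` (`⟨f_J, 1⟩_π = 0` for `J ≠ ∅`), `mem_orthEigenvalues_hypercube`, hence
  **`γ ≤ 1/n`** (`hypercube_spectralGap_le`, via `J = {j}`: "Each `f_J` with `|J| = 1` has
  corresponding eigenvalue `λ₂ = 1 − 1/n`");
* the converse inequality **`γ⋆ ≥ 1/n`** (`hypercube_absSpectralGap_ge`) is obtained here through
  Theorem 13.1 (M. F. Chen 1998) from the exact one-step identity `E ρ_H(X₁ˣ, X₁ʸ) = (1 − 1/n)ρ_H(x,y)`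
  of the grand (random-refresh) coupling for ALL pairs (`hypercube_randomMapExpected_eq`,
  `hammingDist_update_update_add`) — a ROUTE deviation from the book, which reads `γ⋆ = 1/n` off the
  complete list of eigenvalues via Lemma 12.12 (product chains); together with `γ⋆ ≤ γ`
  (`absSpectralGap_le_spectralGap`, needing irreducibility `lazyHypercubeWalk_isIrreducible`) this
  gives **`γ = γ⋆ = 1/n`** and **`t_rel = n`** (`LevinPeres2017_example_12_16_gap`,
  `LevinPeres2017_example_12_16_absGap`, `LevinPeres2017_example_12_16_trel`) ("consequently
  `γ⋆ = 1/n`") [cite: LevinPeres2017, §12.4 Example 12.16];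
* "Theorem 12.4 gives `t_mix(ε) ≤ n(−log ε + log(2ⁿ))`": here in the tree's form of Theorem 12.4,
  `t_mix(ε) ≤ ⌈n·log(2ⁿ/(2ε))⌉` (`LevinPeres2017_example_12_16_tmix`) [cite: LevinPeres2017, §12.4
  Example 12.16 (last display) with §12.2 Thm 12.4]; and from Theorem 12.5 with `λ₂ = 1 − 1/n`:
  `d(t) ≤ ε ⇒ t ≥ (n − 1)log(1/(2ε))` (`LevinPeres2017_example_12_16_tmix_lower`) [cite:
  LevinPeres2017, §12.2 Thm 12.5]; and Proposition 7.14 (`HypercubeLowerBound.lean`) turned into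
  **`t_mix(ε) > ½ n log n − αn` for `ε < 1 − 8e^{2−2α}`** (`LevinPeres2017_prop_7_14_tmix`, using
  eq. (5.6) for the existence of a mixing time) [cite: LevinPeres2017, §7.3.1 Prop. 7.14].

Context (cell pub-lqcd, venture LatticeQCDFlow): the cleanest worked example in which the
relaxation time (`n`), the coupling upper bound (`n log n`, eq. (5.6)) and the Wilson-type lower
bound (`½ n log n`, Prop. 7.14) of one sampler can be compared exactly.
-/

namespace Literature.Probability.MarkovChains

open Finset Function
open scoped Matrix

variable {V : Type*} [Fintype V] [DecidableEq V]

/-! ## The eigenfunctions `f_J` -/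

/-- The spin `x_j ∈ {−1, 1}` of a bit. [cite: LevinPeres2017, §12.4 Example 12.16 ("write the state
space as `{−1,1}ⁿ`")] -/
def spinSign (x : V → Bool) (j : V) : ℝ := bif x j then 1 else -1

/-- **`f_J(x) = Π_{j∈J} x_j`.** [cite: LevinPeres2017, §12.4 Example 12.16] -/
def spinProd (J : Finset V) (x : V → Bool) : ℝ := ∏ j ∈ J, spinSign x j

omit [Fintype V] in
/-- `x_j` is unchanged by refreshing another coordinate. [cite: LevinPeres2017, §12.4 Example 12.16] -/
theorem spinSign_update_of_ne (x : V → Bool) {i j : V} (h : j ≠ i) (b : Bool) :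
    spinSign (update x i b) j = spinSign x j := by
  unfold spinSign; rw [update_of_ne h]

omit [Fintype V] in
/-- `f_J(x^{i←b}) = f_J(x)` for `i ∉ J`. [cite: LevinPeres2017, §12.4 Example 12.16 (the factor
`1 − 1{i∈J}`)] -/
theorem spinProd_update_of_not_mem {J : Finset V} {i : V} (hi : i ∉ J) (x : V → Bool) (b : Bool) :
    spinProd J (update x i b) = spinProd J x :=
  prod_congr rfl fun _ hj => spinSign_update_of_ne x (ne_of_mem_of_not_mem hj hi) b

omit [Fintype V] in
/-- `Σ_b f_J(x^{i←b}) = 0` for `i ∈ J` (a refreshed sign is centred: `P I₁ = ½ − ½ = 0`).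
[cite: LevinPeres2017, §12.4 Example 12.16 (eq. (12.25) and "`PI₁(x) = 0`")] -/
theorem sum_bool_spinProd_update_of_mem {J : Finset V} {i : V} (hi : i ∈ J) (x : V → Bool) :
    ∑ b : Bool, spinProd J (update x i b) = 0 := by
  unfold spinProd
  have h : ∀ b : Bool, ∏ j ∈ J, spinSign (update x i b) j =
      spinSign (update x i b) i * ∏ j ∈ J.erase i, spinSign x j := by
    intro b
    rw [← mul_prod_erase J _ hi]
    congr 1
    exact prod_congr rfl fun j hj => spinSign_update_of_ne x (ne_of_mem_erase hj) b
  simp_rw [h]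
  rw [← sum_mul, Fintype.sum_bool]
  unfold spinSign
  rw [update_self, update_self]
  simp

omit [Fintype V] [DecidableEq V] in
/-- `x_j = 2(bitVal x j − ½)`. [cite: LevinPeres2017, §12.4 Example 12.16 (`{0,1}ⁿ` vs `{−1,1}ⁿ`)] -/
theorem spinSign_eq_two_mul (x : V → Bool) (j : V) : spinSign x j = 2 * (bitVal x j - 1 / 2) := by
  unfold spinSign bitVal; cases x j <;> norm_num

variable [Nonempty V]

/-- **EXAMPLE 12.16: `P f_J = ((n − |J|)/n)·f_J`** for the lazy random walk on the `n`-dimensional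
hypercube. [cite: LevinPeres2017, §12.4 Example 12.16 ("`f_J` … is an eigenfunction. The
corresponding eigenvalue is `λ_J = (n − |J|)/n`")] -/
theorem LevinPeres2017_example_12_16 (J : Finset V) :
    lazyHypercubeWalk V *ᵥ spinProd J =
      (((Fintype.card V : ℝ) - J.card) / Fintype.card V) • spinProd J := by
  funext x
  show ∑ y, lazyHypercubeWalk V x y * spinProd J y = _
  rw [Pi.smul_apply, smul_eq_mul]
  unfold lazyHypercubeWalk
  rw [randomMapKernel_sum_mul, Fintype.sum_prod_type]
  unfold refreshWeight refreshMap
  simp only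
  rw [← sum_add_sum_compl J]
  have hin : ∑ i ∈ J, ∑ b : Bool, (Fintype.card V : ℝ)⁻¹ * (1 / 2) * spinProd J (update x i b) = 0 := by
    refine sum_eq_zero fun i hi => ?_
    rw [← mul_sum, sum_bool_spinProd_update_of_mem hi, mul_zero]
  have hout : ∑ i ∈ Jᶜ, ∑ b : Bool, (Fintype.card V : ℝ)⁻¹ * (1 / 2) * spinProd J (update x i b) =
      ∑ i ∈ Jᶜ, (Fintype.card V : ℝ)⁻¹ * spinProd J x := by
    refine sum_congr rfl fun i hi => ?_
    simp_rw [spinProd_update_of_not_mem (mem_compl.1 hi) x]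
    rw [Fintype.sum_bool]; ring
  rw [hin, hout, zero_add, sum_const, card_compl, nsmul_eq_mul,
    Nat.cast_sub (card_le_univ J)]
  have hn : (Fintype.card V : ℝ) ≠ 0 := by exact_mod_cast Fintype.card_pos.ne'
  field_simp

omit [Nonempty V] in
/-- `⟨f_J, 1⟩_π = Σ_x π(x) f_J(x) = 0` for `J ≠ ∅` (flip a coordinate `j ∈ J`).
[cite: LevinPeres2017, §12.4 Example 12.16 with §12.1 (eigenfunctions `≠ 1` are orthogonal to `1`)] -/
theorem spinProd_orth {J : Finset V} (hJ : J.Nonempty) :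
    ∑ x, uniformCube V x * spinProd J x = 0 := by
  obtain ⟨j, hj⟩ := hJ
  unfold uniformCube
  rw [← mul_sum]
  have h : ∑ x : V → Bool, spinProd J x = 0 := by
    have e : ∀ x : V → Bool, spinProd J x =
        2 * ((bitVal x j - 1 / 2) * ∏ k ∈ J.erase j, spinSign x k) := by
      intro x
      unfold spinProd
      rw [← mul_prod_erase J _ hj, spinSign_eq_two_mul]
      ring
    simp_rw [e]
    rw [← mul_sum, sum_centered_mul_eq_zero j (fun x => prod_congr rfl fun k hk =>
      spinSign_update_of_ne x (ne_of_mem_erase hk) _), mul_zero]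
  rw [h, mul_zero]

omit [Fintype V] [DecidableEq V] [Nonempty V] in
/-- `f_J ≢ 0` (`f_J(𝟙) = 1`). [cite: LevinPeres2017, §12.4 Example 12.16] -/
theorem spinProd_ne_zero (J : Finset V) : spinProd J ≠ 0 := by
  intro h
  have h1 := congrFun h (fun _ => true)
  unfold spinProd spinSign at h1
  simp at h1

/-- `(n − |J|)/n` is an eigenvalue with an eigenfunction orthogonal to the constants (`J ≠ ∅`).
[cite: LevinPeres2017, §12.4 Example 12.16] -/
theorem mem_orthEigenvalues_hypercube {J : Finset V} (hJ : J.Nonempty) :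
    ((Fintype.card V : ℝ) - J.card) / Fintype.card V ∈
      orthEigenvalues (uniformCube V) (lazyHypercubeWalk V) :=
  ⟨spinProd J, spinProd_ne_zero J, spinProd_orth hJ, LevinPeres2017_example_12_16 J⟩

omit [Nonempty V] in
/-- `π > 0`. [cite: LevinPeres2017, §2.3] -/
theorem uniformCube_pos (x : V → Bool) : 0 < uniformCube V x := by
  unfold uniformCube
  exact inv_pos.2 (by exact_mod_cast Fintype.card_pos)

omit [Fintype V] [DecidableEq V] in
/-- `{0,1}^V` has at least two points. [cite: LevinPeres2017, §2.3] -/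
theorem hypercube_nontrivial : Nontrivial (V → Bool) :=
  ⟨⟨fun _ => true, fun _ => false, fun h => Bool.noConfusion (congrFun h (Classical.arbitrary V))⟩⟩

/-- **`γ ≤ 1/n`**: "Each `f_J` with `|J| = 1` has corresponding eigenvalue `λ₂ = 1 − 1/n`".
[cite: LevinPeres2017, §12.4 Example 12.16] -/
theorem hypercube_spectralGap_le :
    spectralGap (uniformCube V) (lazyHypercubeWalk V) ≤ 1 / (Fintype.card V : ℝ) := by
  obtain ⟨j⟩ := ‹Nonempty V›
  haveI := hypercube_nontrivial (V := V)
  have hmem := mem_orthEigenvalues_hypercube (V := V) (singleton_nonempty j)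
  rw [card_singleton, Nat.cast_one] at hmem
  have h := le_of_mem_orthEigenvalues uniformCube_pos lazyHypercubeWalk_isRowStochastic
    lazyHypercubeWalk_isStationary hmem
  rw [LevinPeres2017_lemma_13_7 uniformCube_pos sum_uniformCube lazyHypercubeWalk_isRowStochastic
    lazyHypercubeWalk_detailedBalance]
  have hn : (0 : ℝ) < Fintype.card V := by exact_mod_cast Fintype.card_pos
  have e : ((Fintype.card V : ℝ) - 1) / Fintype.card V = 1 - 1 / Fintype.card V := by field_simp
  linarith

/-! ## The grand coupling contracts the Hamming metric by exactly `1 − 1/n` -/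

omit [Fintype V] [Nonempty V] in
/-- Refreshing coordinate `i` in both configurations with the same bit removes `i` from the set of
disagreements and changes nothing else: `ρ_H(x^{i←b}, y^{i←b}) + 1{x_i ≠ y_i} = ρ_H(x,y)`.
[cite: LevinPeres2017, §5.3.1 (the coordinate-refresh coupling of the hypercube walk)] -/
theorem hammingDist_update_update_add [Fintype V] (x y : V → Bool) (i : V) (b : Bool) :
    hammingDist (update x i b) (update y i b) + (if x i ≠ y i then 1 else 0) = hammingDist x y := by
  unfold hammingDist
  have hset : (univ.filter fun k => update x i b k ≠ update y i b k) =
      (univ.filter fun k => x k ≠ y k).erase i := by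
    ext k
    simp only [mem_filter, mem_univ, true_and, mem_erase]
    by_cases hk : k = i
    · subst hk; simp
    · rw [update_of_ne hk, update_of_ne hk]; exact ⟨fun h => ⟨hk, h⟩, fun h => h.2⟩
  rw [hset]
  by_cases hi : x i ≠ y i
  · rw [if_pos hi]
    exact card_erase_add_one (s := univ.filter fun k => x k ≠ y k) (a := i)
      (mem_filter.2 ⟨mem_univ i, hi⟩)
  · rw [if_neg hi, add_zero]
    exact congrArg Finset.card (erase_eq_of_notMem (s := univ.filter fun k => x k ≠ y k) (a := i)
      (fun h => hi (mem_filter.1 h).2))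

/-- **`E ρ_H(X₁ˣ, X₁ʸ) = (1 − 1/n) ρ_H(x,y)` for EVERY pair** under the grand (random-refresh)
coupling: each disagreeing coordinate is repaired with probability `1/n`. [cite: LevinPeres2017,
§5.3.1 (the hypercube coupling) with §13.1 Thm 13.1 (the hypothesis `ρ_K(P(x,·),P(y,·)) ≤ θρ(x,y)`)] -/
theorem hypercube_randomMapExpected_eq (x y : V → Bool) :
    randomMapExpected (refreshWeight V) refreshMap (fun a b => (hammingDist a b : ℝ)) x y =
      (1 - (Fintype.card V : ℝ)⁻¹) * hammingDist x y := by
  unfold randomMapExpected refreshWeight refreshMap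
  rw [Fintype.sum_prod_type]
  simp only
  have h : ∀ i : V, ∑ b : Bool, (Fintype.card V : ℝ)⁻¹ * (1 / 2) *
      (hammingDist (update x i b) (update y i b) : ℝ) =
        (Fintype.card V : ℝ)⁻¹ * ((hammingDist x y : ℝ) - if x i ≠ y i then 1 else 0) := by
    intro i
    have e : ∀ b : Bool, (hammingDist (update x i b) (update y i b) : ℝ) =
        (hammingDist x y : ℝ) - if x i ≠ y i then 1 else 0 := by
      intro b
      have := hammingDist_update_update_add x y i b
      rw [eq_sub_iff_add_eq]
      exact_mod_cast this
    simp_rw [e]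
    rw [Fintype.sum_bool]; ring
  simp_rw [h]
  rw [← mul_sum, sum_sub_distrib, sum_const, card_univ, nsmul_eq_mul]
  have hcount : ∑ i, (if x i ≠ y i then (1 : ℝ) else 0) = hammingDist x y := by
    unfold hammingDist
    rw [card_filter]
    push_cast
    rfl
  rw [hcount]
  have hn : (Fintype.card V : ℝ) ≠ 0 := by exact_mod_cast Fintype.card_pos.ne'
  field_simp

/-- **`γ⋆ ≥ 1/n`** for the lazy hypercube walk, by Theorem 13.1 with the Hamming metric and
`θ = 1 − 1/n`. [cite: LevinPeres2017, §12.4 Example 12.16 ("consequently `γ⋆ = 1/n`") with §13.1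
Thm 13.1] -/
theorem hypercube_absSpectralGap_ge :
    1 / (Fintype.card V : ℝ) ≤ absSpectralGap (lazyHypercubeWalk V) := by
  have hn : (0 : ℝ) < Fintype.card V := by exact_mod_cast Fintype.card_pos
  have hθ : 0 ≤ 1 - (Fintype.card V : ℝ)⁻¹ := by
    rw [sub_nonneg]; exact inv_le_one_of_one_le₀ (by exact_mod_cast Fintype.card_pos)
  have h := LevinPeres2017_thm_13_1_gap (P := lazyHypercubeWalk V) lazyHypercubeWalk_isRowStochastic
    (ρ := fun a b => (hammingDist a b : ℝ)) (fun a b => Nat.cast_nonneg _)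
    (fun a b hab => by exact_mod_cast hammingDist_pos.2 hab) hθ (fun x y => by
      refine ⟨fun a b => randomMapCoupling (refreshWeight V) refreshMap (x, y) (a, b),
        randomMapCoupling_isMarkovianCoupling refreshWeight_nonneg x y, le_of_eq ?_⟩
      rw [← hypercube_randomMapExpected_eq x y, ← sum_randomMapCoupling_mul,
        Fintype.sum_prod_type])
  have e : 1 - (1 - (Fintype.card V : ℝ)⁻¹) = 1 / Fintype.card V := by ring
  linarith

/-! ## Irreducibility, and `γ = γ⋆ = 1/n`, `t_rel = n` -/

/-- Powers of a kernel with non-negative entries have non-negative entries. [cite: LevinPeres2017, §1.1] -/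
private theorem pow_apply_nonneg {X : Type*} [Fintype X] [DecidableEq X] {P : Matrix X X ℝ}
    (hP : ∀ a b, 0 ≤ P a b) : ∀ (m : ℕ) (a b : X), 0 ≤ (P ^ m) a b := by
  intro m
  induction m with
  | zero => intro a b; rw [pow_zero, Matrix.one_apply]; split_ifs <;> norm_num
  | succ m ih =>
      intro a b
      rw [pow_succ, Matrix.mul_apply]
      exact sum_nonneg fun c _ => mul_nonneg (ih a c) (hP c b)

/-- The lazy hypercube walk is irreducible: `P^{ρ_H(x,y)}(x,y) > 0` (flip the disagreeing coordinates
one at a time). [cite: LevinPeres2017, §2.3 (the hypercube graph is connected) with §1.3 (irreducibility)] -/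
theorem lazyHypercubeWalk_isIrreducible : IsIrreducible (lazyHypercubeWalk V) := by
  set P : Matrix (V → Bool) (V → Bool) ℝ := lazyHypercubeWalk V with hPdef
  have hP0 : ∀ a b, 0 ≤ P a b := lazyHypercubeWalk_isRowStochastic.1
  have key : ∀ (k : ℕ) (x y : V → Bool), hammingDist x y = k → 0 < (P ^ k) x y := by
    intro k
    induction k with
    | zero =>
        intro x y h
        rw [hammingDist_eq_zero] at h
        subst h
        rw [pow_zero, Matrix.one_apply_eq]; norm_num
    | succ k ih =>
        intro x y h
        -- a disagreeing coordinate `i`; set it right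
        have hne : (univ.filter fun j => x j ≠ y j).Nonempty := by
          rw [← card_pos]; unfold hammingDist at h; omega
        obtain ⟨i, hi⟩ := hne
        have hxi : x i ≠ y i := (mem_filter.1 hi).2
        have hyi : y i = !x i := by
          cases hx : x i <;> cases hy : y i <;> simp_all
        set x' := update x i (y i) with hx'
        have hdist : hammingDist x' y = k := by
          have h2 := hammingDist_update_update_add x y i (y i)
          rw [update_eq_self, if_pos hxi, h, ← hx'] at h2
          omega
        have hstep : 0 < P x x' := by
          rw [hPdef, hx', hyi, lazyHypercubeWalk_apply_flip]
          have : (0 : ℝ) < Fintype.card V := by exact_mod_cast Fintype.card_pos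
          positivity
        rw [pow_succ', Matrix.mul_apply]
        calc (0 : ℝ) < P x x' * (P ^ k) x' y := mul_pos hstep (ih x' y hdist)
          _ ≤ ∑ z, P x z * (P ^ k) z y :=
              single_le_sum (f := fun z => P x z * (P ^ k) z y)
                (fun z _ => mul_nonneg (hP0 x z) (pow_apply_nonneg hP0 k z y)) (mem_univ x')
  exact fun x y => ⟨hammingDist x y, key _ x y rfl⟩

/-- **EXAMPLE 12.16: `γ = 1/n`** for the lazy random walk on the `n`-dimensional hypercube.
[cite: LevinPeres2017, §12.4 Example 12.16] -/
theorem LevinPeres2017_example_12_16_gap :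
    spectralGap (uniformCube V) (lazyHypercubeWalk V) = 1 / (Fintype.card V : ℝ) := by
  haveI := hypercube_nontrivial (V := V)
  have h1 := hypercube_spectralGap_le (V := V)
  have h2 := hypercube_absSpectralGap_ge (V := V)
  have h3 := absSpectralGap_le_spectralGap (π := uniformCube V) (P := lazyHypercubeWalk V)
    uniformCube_pos sum_uniformCube lazyHypercubeWalk_isRowStochastic
    lazyHypercubeWalk_detailedBalance lazyHypercubeWalk_isIrreducible
  linarith

/-- **EXAMPLE 12.16: `γ⋆ = 1/n`** ("consequently `γ⋆ = 1/n`"). [cite: LevinPeres2017, §12.4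
Example 12.16] -/
theorem LevinPeres2017_example_12_16_absGap :
    absSpectralGap (lazyHypercubeWalk V) = 1 / (Fintype.card V : ℝ) := by
  haveI := hypercube_nontrivial (V := V)
  have h1 := hypercube_spectralGap_le (V := V)
  have h2 := hypercube_absSpectralGap_ge (V := V)
  have h3 := absSpectralGap_le_spectralGap (π := uniformCube V) (P := lazyHypercubeWalk V)
    uniformCube_pos sum_uniformCube lazyHypercubeWalk_isRowStochastic
    lazyHypercubeWalk_detailedBalance lazyHypercubeWalk_isIrreducible
  linarith

/-- **EXAMPLE 12.16: `t_rel = n`** for the lazy random walk on the `n`-dimensional hypercube.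
[cite: LevinPeres2017, §12.4 Example 12.16 with §12.2 (`t_rel = 1/γ⋆`)] -/
theorem LevinPeres2017_example_12_16_trel :
    relaxationTime (lazyHypercubeWalk V) = Fintype.card V := by
  unfold relaxationTime
  rw [LevinPeres2017_example_12_16_absGap, one_div_one_div]

/-- "Theorem 12.4 gives `t_mix(ε) ≤ n(−log ε + log(2ⁿ))`" — here with the tree's Theorem 12.4
(`t_mix(ε) ≤ ⌈t_rel·log(1/(2επ_min))⌉`, `π_min = 2^{−n}`): **`t_mix(ε) ≤ ⌈n·log(|{0,1}ⁿ|/(2ε))⌉`**.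
[cite: LevinPeres2017, §12.4 Example 12.16 (last display) with §12.2 Thm 12.4] -/
theorem LevinPeres2017_example_12_16_tmix {ε : ℝ} (hε : 0 < ε) :
    mixingTime (lazyHypercubeWalk V) (uniformCube V) ε ≤
      ⌈(Fintype.card V : ℝ) * Real.log (Fintype.card (V → Bool) / (2 * ε))⌉₊ := by
  have hgap : lambdaStar (lazyHypercubeWalk V) < 1 := by
    have h := hypercube_absSpectralGap_ge (V := V)
    unfold absSpectralGap at h
    have : (0 : ℝ) < 1 / Fintype.card V := by
      have : (0 : ℝ) < Fintype.card V := by exact_mod_cast Fintype.card_pos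
      positivity
    linarith
  have h := LevinPeres2017_thm_12_4 uniformCube_pos sum_uniformCube lazyHypercubeWalk_isRowStochastic
    lazyHypercubeWalk_detailedBalance lazyHypercubeWalk_isIrreducible hgap
    (πmin := uniformCube V (fun _ => true)) (uniformCube_pos _) (fun x => le_refl _) hε
  rw [LevinPeres2017_example_12_16_trel] at h
  convert h using 3
  unfold uniformCube
  have hc : (0 : ℝ) < Fintype.card (V → Bool) := by exact_mod_cast Fintype.card_pos
  field_simp

/-- The companion lower bound from Theorem 12.5 (`t_mix(ε) ≥ (t_rel − 1)log(1/(2ε))`) with the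
eigenvalue `1 − 1/n` of `f_{j}`: **if `d(t) ≤ ε` then `t ≥ (n − 1)·log(1/(2ε))`**.
[cite: LevinPeres2017, §12.4 Example 12.16 (`λ₂ = 1 − 1/n`) with §12.2 Thm 12.5] -/
theorem LevinPeres2017_example_12_16_tmix_lower {ε : ℝ} (hε : 0 < ε) {t : ℕ}
    (ht : worstTvDist (lazyHypercubeWalk V) (uniformCube V) t ≤ ε) :
    ((Fintype.card V : ℝ) - 1) * Real.log (1 / (2 * ε)) ≤ t := by
  obtain ⟨j⟩ := ‹Nonempty V›
  set n : ℝ := (Fintype.card V : ℝ) with hn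
  have hn0 : 0 < n := by rw [hn]; exact_mod_cast Fintype.card_pos
  have hn1 : 1 ≤ n := by rw [hn]; exact_mod_cast Fintype.card_pos
  -- the real eigen-relation for `f_{j}`, eigenvalue `(n − 1)/n`
  have hreal : ∀ x, ∑ y, lazyHypercubeWalk V x y * spinProd {j} y = (n - 1) / n * spinProd {j} x := by
    intro x
    have h := congrFun (LevinPeres2017_example_12_16 (V := V) {j}) x
    rw [Pi.smul_apply, smul_eq_mul, card_singleton, Nat.cast_one] at h
    exact h
  set lam : ℂ := (((n - 1) / n : ℝ) : ℂ) with hlam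
  have hf : ∀ x, ∑ y, (lazyHypercubeWalk V x y : ℂ) * (fun z => (spinProd {j} z : ℂ)) y =
      lam * (fun z => (spinProd {j} z : ℂ)) x := by
    intro x
    simp only [hlam]
    have h := hreal x
    exact_mod_cast congrArg (fun r : ℝ => (r : ℂ)) h
  have hf0 : (fun z => (spinProd ({j} : Finset V) z : ℂ)) ≠ 0 := by
    intro h
    have h1 := congrFun h (fun _ => true)
    unfold spinProd spinSign at h1
    simp at h1
  have hnorm : ‖lam‖ = (n - 1) / n := by
    rw [hlam, Complex.norm_real, Real.norm_eq_abs, abs_of_nonneg (div_nonneg (by linarith) hn0.le)]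
  have hlam1 : ‖lam‖ < 1 := by
    rw [hnorm, div_lt_one hn0]; linarith
  have hlamne : lam ≠ 1 := by
    intro h
    have : ‖lam‖ = 1 := by rw [h, norm_one]
    linarith
  have h := LevinPeres2017_thm_12_5 (lazyHypercubeWalk_isStationary (V := V)) hf hf0 hlamne hlam1 hε ht
  rw [hnorm] at h
  have e : 1 / (1 - (n - 1) / n) - 1 = n - 1 := by
    field_simp
    ring
  rwa [e] at h

/-- Proposition 7.14 as a mixing-time statement: **for `0 < ε < 1 − 8e^{2−2α}`,
`t_mix(ε) > ½ n log n − αn`** (every natural `t ≤ ½ n log n − αn` has `d(t) ≥ 1 − 8e^{2−2α} > ε`,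
and some time mixes by eq. (5.6), so the least `ε`-mixing time lies beyond the window).
[cite: LevinPeres2017, §7.3.1 Prop. 7.14, eq. (7.20) with §4.5 eq. (4.30) (definition of `t_mix(ε)`)] -/
theorem LevinPeres2017_prop_7_14_tmix (hn : 2 ≤ Fintype.card V) {α ε : ℝ} (hε : 0 < ε)
    (hεα : ε < 1 - 8 * Real.exp (2 - 2 * α)) :
    Fintype.card V * Real.log (Fintype.card V) / 2 - α * Fintype.card V <
      (mixingTime (lazyHypercubeWalk V) (uniformCube V) ε : ℝ) := by
  by_contra hle
  rw [not_lt] at hle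
  -- some time mixes (eq. (5.6)), so `d(t_mix(ε)) ≤ ε`
  set T : ℕ := ⌈Fintype.card V * Real.log (Fintype.card V) + Fintype.card V * Real.log (1 / ε)⌉₊
  have hT : worstTvDist (lazyHypercubeWalk V) (uniformCube V) T ≤ ε := by
    have h := LevinPeres2017_eq_5_6_tail (V := V) (c := Real.log (1 / ε)) (t := T)
      (by have := Nat.le_ceil (Fintype.card V * Real.log (Fintype.card V) +
            Fintype.card V * Real.log (1 / ε)); linarith)
    rwa [one_div, Real.log_inv, neg_neg, Real.exp_log hε] at h
  have hmix := worstTvDist_mixingTime_le (lazyHypercubeWalk V) (uniformCube V) hT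
  have hlow := LevinPeres2017_prop_7_14 (V := V) hn α hle
  linarith

end Literature.Probability.MarkovChains
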